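/-
Origin: expansion seat `prover-pub-hodgecm-mc-binder-1-0`, handover #3 2026-08-18T18:53Z md5 f2bf400a8213dcb740869268102e6123 (NEW, 332 l.; rewrites import McB1.IchinoFockKTypes -> HodgeCM.Literature.IchinoFockKTypes x1; audited names: HodgeCM.Literature.Ichino2022.WorkedLines.corresponds_wedge_iff_posPlane, HodgeCM.Literature.Ichino2022.WorkedLines.corresponds_trivial_iff_negPlane, HodgeCM.Literature.Ichino2022.WorkedLines.corresponds_trivial_iff_mixedPlane) (`HOME/mc/pub-hodgecm-mc-binder-1/lean/McB1/IchinoFockKTypesPlanes.lean`, md5 f2bf400a, 332 lines);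
landed by the packager successor (mc-unitary-1-g3, gen-8 kit) in gate run 32 as `HodgeCM/Literature/IchinoFockKTypesPlanes.lean` (import ^import McB1\.IchinoFockKTypes[ \t]*$→import HodgeCM.Literature.IchinoFockKTypes ×1).
-/
/-
Copyright (c) 2026 the pub-hodgecm formalisation cell (harness21).  New file, not vendored (same author as the tree copy).
Origin: HOME/mc/pub-hodgecm-mc-binder-1/lean/McB1/IchinoFockKTypesPlanes.lean — session prover-pub-hodgecm-mc-binder-1-0 (unit
pub-hodgecm-mc-binder-1, MODEL-CONSTRUCTION sub-cell, BINDER PROVER hbr/hQ/hch).  Intended final place: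
`HodgeCM/Literature/IchinoFockKTypesPlanes.lean` (module `HodgeCM.Literature.IchinoFockKTypesPlanes`); PACKAGE COPY of the hub-tree module
`Literature.RepresentationTheory.Ichino2022.FockKTypeWorkedPlanes` (proposed to the hub gate by the same seat; the package cannot
import the tree — CONTRIBUTING §1), namespace `HodgeCM.Literature.Ichino2022` instead of
`Literature.RepresentationTheory.Ichino2022`, otherwise byte-for-byte the same declarations.  Imports: `McB1.IchinoFockKTypes` ↦ `HodgeCM.Literature.IchinoFockKTypes` (ONE rewrite).
KIND: PRINT transcription (dictionary level, nothing asserted) + kernel arithmetic.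
-/
import Summits.HodgeConjecture.HodgeCM.Literature.IchinoFockKTypes

set_option autoImplicit false

/-!
# Ichino (2022) Lemma 7.10 — worked lines II: hermitian PLANES against `U(r)` (compact) and `U(2,1)`

Companion of `HodgeCM.Literature.IchinoFockKTypes` (tree: `Literature.RepresentationTheory.Ichino2022.FockKTypeCorrespondence`) (verbatim transcription of
A. Ichino, Adv. Math. 398 (2022) 108188 = arXiv:2008.06174, §4.1 + §7.5 Lemma 7.10 [Ichino2022ThetaReal]).
Four SPECIAL CASES of Lemma 7.10 for a two-dimensional `W`, each an `↔` proved by arithmetic on the weights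
from the hypothesis `(h : D.Lemma_7_10)` — nothing asserted:

* `corresponds_wedge_iff_posPlane` — `(p,q;r,s) = (2,0;2,1)`: the `K′ = U(2) × U(1)`-type `(1,1;−2)`
  (`= ∧²𝔭₊`, the type of holomorphic two-forms on the ball) is harmonic iff EITHER `n₀ = −2`, paired with
  the character `((3+m₀)/2, (3+m₀)/2)` of `U(2)` (`a = (1,1)`), OR `n₀ = 0`, paired with the two-dimensional
  type `((1+m₀)/2, (m₀−1)/2)` (`b = (−1)`) — so "the `(1,1;−2)`-harmonics are a line on which `U(2)_W` acts by
  `det` times a character" singles out the splitting with `n₀ = −2`;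
* `corresponds_trivial_iff_posPlane` — `(2,0)`, `s = 0`, `r ≥ 3`: the trivial `U(r)`-type is harmonic iff
  `n₀ = −2`, paired with the character `((r+m₀)/2, (r+m₀)/2)`;
* `corresponds_trivial_iff_negPlane` — `(0,2)`: iff `n₀ = +2`, paired with `((m₀−r)/2, (m₀−r)/2)`;
* `corresponds_trivial_iff_mixedPlane` — `(1,1)`, `s = 0`, `r ≥ 3`: iff `n₀ = 0`, paired with the
  `U(1) × U(1)`-character `((r+m₀)/2; (m₀−r)/2)`.

## References
* A. Ichino, Adv. Math. 398 (2022) 108188, §4.1, §7.5 Lemma 7.10. [Ichino2022ThetaReal]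
-/

namespace HodgeCM.Literature.Ichino2022

namespace WorkedLines

open FockHarmonics HarmonicParam

variable {S : SplittingDatum} (D : FockHarmonics S)

/-- **`(U(2), U(2,1))`, positive-definite plane** (`(p,q;r,s) = (2,0;2,1)`): the `K′`-type `(1,1;−2)`
(`= ∧²𝔭₊`, the type of holomorphic two-forms) is harmonic in exactly two ways — EITHER `n₀ = −2` and it is
paired with the CHARACTER `det ⊗ (shift)` of `U(2)`, i.e. `μ = ((3+m₀)/2, (3+m₀)/2)` (`a = (1,1)`), OR
`n₀ = 0` and it is paired with the two-dimensional type `μ = ((1+m₀)/2, (m₀−1)/2)` (`b = (−1)`).  So "the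
`κ`-harmonics form a line on which `U(2)_W` acts by `det` times the vacuum character" holds iff the
plane's splitting character has `n₀ = −2`. [cite: Ichino2022ThetaReal, §7.5 Lemma 7.10] -/
theorem corresponds_wedge_iff_posPlane (h : D.Lemma_7_10) (hp : S.p = 2) (hq : S.q = 0) (hr : S.r = 2)
    (hs : S.s = 1) (μ : KWt S.p S.q) (μ' : KWt S.r S.s)
    (h0 : μ'.1 ⟨0, by omega⟩ = 1) (h1 : μ'.1 ⟨1, by omega⟩ = 1) (h2 : μ'.2 ⟨0, by omega⟩ = -2) :
    D.corresponds μ μ' ↔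
      (S.n₀ = -2 ∧ ∀ i, μ.1 i = (3 + (S.m₀ : ℚ)) / 2) ∨
      (S.n₀ = 0 ∧ μ.1 ⟨0, by omega⟩ = (1 + (S.m₀ : ℚ)) / 2 ∧ μ.1 ⟨1, by omega⟩ = ((S.m₀ : ℚ) - 1) / 2) := by
  constructor
  · intro hc
    obtain ⟨P, hμ, hμ'P⟩ := (h _ _).mp hc
    have hPq : P.qp + P.qm ≤ S.q := P.hq
    have hPs : P.pm + P.qp ≤ S.s := P.hs
    have hPp : P.pp + P.pm ≤ S.p := P.hp
    have hPr : P.pp + P.qm ≤ S.r := P.hr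
    have hqm : P.qm = 0 := by omega
    have hqp : P.qp = 0 := by omega
    rcases Nat.lt_or_ge 0 P.pm with hpm | hpm
    · -- `p⁻ = 1`: the second case
      have hpm1 : P.pm = 1 := by omega
      have e1 := h1
      rw [hμ'P, mu'_fst_apply, pad_mid _ _ _ _ (by simp; omega) (by simp; omega), hp, hq] at e1
      push_cast at e1
      have hn : (S.n₀ : ℚ) = 0 := by linarith
      have hn' : S.n₀ = 0 := by exact_mod_cast hn
      have e2 := h2
      rw [hμ'P, mu'_snd_apply, pad_tail _ _ _ _ (by simp; omega) (by simp; omega), hp, hq, hn] at e2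
      push_cast at e2
      have hb : (P.b ⟨0 - (S.s - P.pm), by omega⟩ : ℚ) = -1 := by linarith
      have hpp : P.pp = 0 := by
        by_contra hne
        have hpos : 0 < P.pp := Nat.pos_of_ne_zero hne
        have e0 := h0
        rw [hμ'P, mu'_fst_apply, pad_head _ _ _ _ (by simp; omega), hp, hq, hn] at e0
        have ha : (1 : ℚ) ≤ P.a ⟨0, hpos⟩ := by exact_mod_cast P.a_pos ⟨0, hpos⟩
        push_cast at e0
        linarith
      refine Or.inr ⟨hn', ?_, ?_⟩
      · rw [hμ, mu_fst_apply, pad_mid _ _ _ _ (by simp; omega) (by simp; omega), hr, hs]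
        push_cast; ring
      · rw [hμ, mu_fst_apply, pad_tail _ _ _ _ (by simp; omega) (by simp; omega), hr, hs]
        have : P.b ⟨1 - (S.p - P.pm), by omega⟩ = P.b ⟨0 - (S.s - P.pm), by omega⟩ := by
          congr 1; exact Fin.ext (by simp; omega)
        rw [this, hb]
        push_cast; ring
    · -- `p⁻ = 0`: the first case
      have hpm0 : P.pm = 0 := by omega
      have e2 := h2
      rw [hμ'P, mu'_snd_apply, pad_mid _ _ _ _ (by simp; omega) (by simp; omega), hp, hq] at e2
      push_cast at e2
      have hn : (S.n₀ : ℚ) = -2 := by linarith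
      have hn' : S.n₀ = -2 := by exact_mod_cast hn
      have hpp : P.pp = 2 := by
        by_contra hne
        have e1 := h1
        rw [hμ'P, mu'_fst_apply, pad_mid _ _ _ _ (by simp; omega) (by simp; omega), hp, hq, hn] at e1
        push_cast at e1
        linarith
      have ha : ∀ (k : ℕ) (hk : k < P.pp), (P.a ⟨k, hk⟩ : ℚ) = 1 := by
        intro k hk
        have hk2 : k = 0 ∨ k = 1 := by omega
        rcases hk2 with rfl | rfl
        · have e0 := h0
          rw [hμ'P, mu'_fst_apply, pad_head _ _ _ _ (by simp; omega), hp, hq, hn] at e0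
          push_cast at e0
          linarith
        · have e1 := h1
          rw [hμ'P, mu'_fst_apply, pad_head _ _ _ _ (by simp; omega), hp, hq, hn] at e1
          push_cast at e1
          linarith
      refine Or.inl ⟨hn', fun i => ?_⟩
      rw [hμ, mu_fst_apply, pad_head _ _ _ _ (by omega), ha i.val (by omega), hr, hs]
      push_cast; ring
  · rintro (⟨hn, hμ⟩ | ⟨hn, hμ0, hμ1⟩)
    · -- `a = (1,1)`
      let P : HarmonicParam S :=
        { pp := 2, pm := 0, qp := 0, qm := 0, a := fun _ => 1, b := Fin.elim0, c := Fin.elim0, d := Fin.elim0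
          a_anti := fun _ _ _ => le_rfl, b_anti := fun i => i.elim0, c_anti := fun i => i.elim0
          d_anti := fun i => i.elim0, a_pos := fun _ => one_pos, b_neg := fun i => i.elim0
          c_pos := fun i => i.elim0, d_neg := fun i => i.elim0
          hp := by omega, hq := by omega, hr := by omega, hs := by omega }
      refine (h _ _).mpr ⟨P, ?_, ?_⟩
      · ext i
        · rw [hμ i, mu_fst_apply, pad_head _ _ _ _ (by show i.val < 2; omega), hr, hs]
          push_cast; ring
        · exact (Fin.cast hq i).elim0
      · ext i
        · rw [mu'_fst_apply, hp, hq, hn, pad_head _ _ _ _ (by show i.val < 2; omega)]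
          have hi : i.val = 0 ∨ i.val = 1 := by have := i.isLt; omega
          rcases hi with hi | hi
          · have : i = ⟨0, by omega⟩ := Fin.ext hi
            rw [this, h0]; push_cast; ring
          · have : i = ⟨1, by omega⟩ := Fin.ext hi
            rw [this, h1]; push_cast; ring
        · rw [mu'_snd_apply, hp, hq, hn]
          have hi : i.val = 0 := by have := i.isLt; omega
          have : i = ⟨0, by omega⟩ := Fin.ext hi
          rw [this, h2, pad_mid _ _ _ _ (by show 0 ≤ 0; omega) (by show 0 < S.s - 0; omega)]
          push_cast; ring
    · -- `b = (−1)`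
      let P : HarmonicParam S :=
        { pp := 0, pm := 1, qp := 0, qm := 0, a := Fin.elim0, b := fun _ => -1, c := Fin.elim0, d := Fin.elim0
          a_anti := fun i => i.elim0, b_anti := fun _ _ _ => le_rfl, c_anti := fun i => i.elim0
          d_anti := fun i => i.elim0, a_pos := fun i => i.elim0, b_neg := fun _ => by norm_num
          c_pos := fun i => i.elim0, d_neg := fun i => i.elim0
          hp := by omega, hq := by omega, hr := by omega, hs := by omega }
      refine (h _ _).mpr ⟨P, ?_, ?_⟩
      · ext i
        · rw [mu_fst_apply, hr, hs]
          have hi : i.val = 0 ∨ i.val = 1 := by have := i.isLt; omega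
          rcases hi with hi | hi
          · have : i = ⟨0, by omega⟩ := Fin.ext hi
            rw [this, hμ0, pad_mid _ _ _ _ (by show 0 ≤ 0; omega) (by show 0 < S.p - 1; omega)]
            push_cast; ring
          · have : i = ⟨1, by omega⟩ := Fin.ext hi
            rw [this, hμ1, pad_tail _ _ _ _ (by show 0 ≤ 1; omega) (by show S.p - 1 ≤ 1; omega)]
            push_cast; ring
        · exact (Fin.cast hq i).elim0
      · ext i
        · rw [mu'_fst_apply, hp, hq, hn, pad_mid _ _ _ _ (by show 0 ≤ i.val; omega)
            (by show i.val < S.r - 0; omega)]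
          have hi : i.val = 0 ∨ i.val = 1 := by have := i.isLt; omega
          rcases hi with hi | hi
          · have : i = ⟨0, by omega⟩ := Fin.ext hi
            rw [this, h0]; push_cast; ring
          · have : i = ⟨1, by omega⟩ := Fin.ext hi
            rw [this, h1]; push_cast; ring
        · rw [mu'_snd_apply, hp, hq, hn]
          have hi : i.val = 0 := by have := i.isLt; omega
          have : i = ⟨0, by omega⟩ := Fin.ext hi
          rw [this, h2, pad_tail _ _ _ _ (by show 0 ≤ 0; omega) (by show S.s - 1 ≤ 0; omega)]
          push_cast; ring

/-- **`(U(2), U(r))`, `r ≥ 3`, definite plane of sign `+` against a compact group** (`(p,q) = (2,0)`,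
`s = 0`): the trivial `U(r)`-type is harmonic iff `n₀ = −2`, and then it is paired with the CHARACTER
`((r + m₀)/2, (r + m₀)/2)` of `U(2)` (the constants). [cite: Ichino2022ThetaReal, §7.5 Lemma 7.10] -/
theorem corresponds_trivial_iff_posPlane (h : D.Lemma_7_10) (hp : S.p = 2) (hq : S.q = 0) (hs : S.s = 0)
    (hr : 3 ≤ S.r) (μ : KWt S.p S.q) (μ' : KWt S.r S.s) (hμ' : ∀ i, μ'.1 i = 0) :
    D.corresponds μ μ' ↔ S.n₀ = -2 ∧ ∀ i, μ.1 i = ((S.r : ℚ) + S.m₀) / 2 := by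
  constructor
  · intro hc
    obtain ⟨P, hμ, hμ'P⟩ := (h _ _).mp hc
    have hPq : P.qp + P.qm ≤ S.q := P.hq
    have hPs : P.pm + P.qp ≤ S.s := P.hs
    have hPp : P.pp + P.pm ≤ S.p := P.hp
    have hqm : P.qm = 0 := by omega
    have hpp : P.pp ≤ 2 := by omega
    -- entry `2` of `μ′` lies in the middle block: `0 = (p − q)/2 + n₀/2 = 1 + n₀/2`
    have e2 := hμ' ⟨2, by omega⟩
    rw [hμ'P, mu'_fst_apply, pad_mid _ _ _ _ (by simp; omega) (by simp; omega), hp, hq] at e2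
    push_cast at e2
    have hn : (S.n₀ : ℚ) = -2 := by linarith
    have hn' : S.n₀ = -2 := by exact_mod_cast hn
    have hpp0 : P.pp = 0 := by
      by_contra hne
      have hpos : 0 < P.pp := Nat.pos_of_ne_zero hne
      have e0 := hμ' ⟨0, by omega⟩
      rw [hμ'P, mu'_fst_apply, pad_head _ _ _ _ (by simp; omega), hp, hq, hn] at e0
      have ha : (1 : ℚ) ≤ P.a ⟨0, hpos⟩ := by exact_mod_cast P.a_pos ⟨0, hpos⟩
      push_cast at e0
      linarith
    refine ⟨hn', fun i => ?_⟩
    rw [hμ, mu_fst_apply, pad_mid _ _ _ _ (by omega) (by have := i.isLt; omega), hs]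
    push_cast
    ring
  · rintro ⟨hn, hμ⟩
    refine (h _ _).mpr ⟨HarmonicParam.vacuum S, ?_, ?_⟩
    · rw [HarmonicParam.vacuum_mu]
      ext i
      · rw [hμ i, hs]; push_cast; ring
      · exact (Fin.cast hq i).elim0
    · rw [HarmonicParam.vacuum_mu']
      ext i
      · rw [hμ' i, hp, hq, hn]; push_cast; ring
      · exact (Fin.cast hs i).elim0

/-- **`(U(2), U(r))`, `r ≥ 3`, definite plane of sign `−`** (`(p,q) = (0,2)`, `s = 0`): the trivial
`U(r)`-type is harmonic iff `n₀ = +2`, paired with the character `((m₀ − r)/2, (m₀ − r)/2)` of `U(2)`.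
[cite: Ichino2022ThetaReal, §7.5 Lemma 7.10] -/
theorem corresponds_trivial_iff_negPlane (h : D.Lemma_7_10) (hp : S.p = 0) (hq : S.q = 2) (hs : S.s = 0)
    (hr : 3 ≤ S.r) (μ : KWt S.p S.q) (μ' : KWt S.r S.s) (hμ' : ∀ i, μ'.1 i = 0) :
    D.corresponds μ μ' ↔ S.n₀ = 2 ∧ ∀ j, μ.2 j = ((S.m₀ : ℚ) - S.r) / 2 := by
  constructor
  · intro hc
    obtain ⟨P, hμ, hμ'P⟩ := (h _ _).mp hc
    have hPq : P.qp + P.qm ≤ S.q := P.hq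
    have hPs : P.pm + P.qp ≤ S.s := P.hs
    have hPp : P.pp + P.pm ≤ S.p := P.hp
    have hpp : P.pp = 0 := by omega
    have hqp : P.qp = 0 := by omega
    have hqm : P.qm ≤ 2 := by omega
    -- entry `0` of `μ′` lies before the `d`-tail (`r ≥ 3 > q⁻`)
    have e0 := hμ' ⟨0, by omega⟩
    rw [hμ'P, mu'_fst_apply, pad_mid _ _ _ _ (by simp; omega) (by simp; omega), hp, hq] at e0
    push_cast at e0
    have hn : (S.n₀ : ℚ) = 2 := by linarith
    have hn' : S.n₀ = 2 := by exact_mod_cast hn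
    have hqm0 : P.qm = 0 := by
      by_contra hne
      have hpos : 0 < P.qm := Nat.pos_of_ne_zero hne
      have e1 := hμ' ⟨S.r - 1, by omega⟩
      rw [hμ'P, mu'_fst_apply, pad_tail _ _ _ _ (by simp; omega) (by simp; omega), hp, hq, hn] at e1
      have hd : (P.d ⟨S.r - 1 - (S.r - P.qm), by omega⟩ : ℚ) ≤ -1 := by
        have := P.d_neg ⟨S.r - 1 - (S.r - P.qm), by omega⟩
        exact_mod_cast Int.le_sub_one_of_lt this
      push_cast at e1
      linarith
    refine ⟨hn', fun j => ?_⟩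
    rw [hμ, mu_snd_apply, pad_mid _ _ _ _ (by omega) (by have := j.isLt; omega), hs]
    push_cast
    ring
  · rintro ⟨hn, hμ⟩
    refine (h _ _).mpr ⟨HarmonicParam.vacuum S, ?_, ?_⟩
    · rw [HarmonicParam.vacuum_mu]
      ext i
      · exact (Fin.cast hp i).elim0
      · rw [hμ i, hs]; push_cast; ring
    · rw [HarmonicParam.vacuum_mu']
      ext i
      · rw [hμ' i, hp, hq, hn]; push_cast; ring
      · exact (Fin.cast hs i).elim0

/-- **`(U(1,1), U(r))`, `r ≥ 3`, plane of signature `(1,1)` against a compact group** (`s = 0`): the trivial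
`U(r)`-type is harmonic iff `n₀ = 0`, and then it is paired with the `K = U(1) × U(1)`-character
`((r + m₀)/2; (m₀ − r)/2)` (the constants; the `U(r)`-invariants are `𝒰(𝔭⁺)·1`).
[cite: Ichino2022ThetaReal, §7.5 Lemma 7.10] -/
theorem corresponds_trivial_iff_mixedPlane (h : D.Lemma_7_10) (hp : S.p = 1) (hq : S.q = 1) (hs : S.s = 0)
    (hr : 3 ≤ S.r) (μ : KWt S.p S.q) (μ' : KWt S.r S.s) (hμ' : ∀ i, μ'.1 i = 0) :
    D.corresponds μ μ' ↔
      S.n₀ = 0 ∧ (∀ i, μ.1 i = ((S.r : ℚ) + S.m₀) / 2) ∧ ∀ j, μ.2 j = ((S.m₀ : ℚ) - S.r) / 2 := by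
  constructor
  · intro hc
    obtain ⟨P, hμ, hμ'P⟩ := (h _ _).mp hc
    have hPq : P.qp + P.qm ≤ S.q := P.hq
    have hPs : P.pm + P.qp ≤ S.s := P.hs
    have hPp : P.pp + P.pm ≤ S.p := P.hp
    have hpm : P.pm = 0 := by omega
    have hqp : P.qp = 0 := by omega
    have hpp : P.pp ≤ 1 := by omega
    have hqm : P.qm ≤ 1 := by omega
    -- entry `1` of `μ′` lies in the middle block (`p⁺ ≤ 1 ≤ 1 < r − q⁻`)
    have e1 := hμ' ⟨1, by omega⟩
    rw [hμ'P, mu'_fst_apply, pad_mid _ _ _ _ (by simp; omega) (by simp; omega), hp, hq] at e1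
    push_cast at e1
    have hn : (S.n₀ : ℚ) = 0 := by linarith
    have hn' : S.n₀ = 0 := by exact_mod_cast hn
    have hpp0 : P.pp = 0 := by
      by_contra hne
      have hpos : 0 < P.pp := Nat.pos_of_ne_zero hne
      have e0 := hμ' ⟨0, by omega⟩
      rw [hμ'P, mu'_fst_apply, pad_head _ _ _ _ (by simp; omega), hp, hq, hn] at e0
      have ha : (1 : ℚ) ≤ P.a ⟨0, hpos⟩ := by exact_mod_cast P.a_pos ⟨0, hpos⟩
      push_cast at e0
      linarith
    have hqm0 : P.qm = 0 := by
      by_contra hne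
      have hpos : 0 < P.qm := Nat.pos_of_ne_zero hne
      have e2 := hμ' ⟨S.r - 1, by omega⟩
      rw [hμ'P, mu'_fst_apply, pad_tail _ _ _ _ (by simp; omega) (by simp; omega), hp, hq, hn] at e2
      have hd : (P.d ⟨S.r - 1 - (S.r - P.qm), by omega⟩ : ℚ) ≤ -1 := by
        have := P.d_neg ⟨S.r - 1 - (S.r - P.qm), by omega⟩
        exact_mod_cast Int.le_sub_one_of_lt this
      push_cast at e2
      linarith
    refine ⟨hn', fun i => ?_, fun j => ?_⟩
    · rw [hμ, mu_fst_apply, pad_mid _ _ _ _ (by omega) (by have := i.isLt; omega), hs]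
      push_cast; ring
    · rw [hμ, mu_snd_apply, pad_mid _ _ _ _ (by omega) (by have := j.isLt; omega), hs]
      push_cast; ring
  · rintro ⟨hn, hμ1, hμ2⟩
    refine (h _ _).mpr ⟨HarmonicParam.vacuum S, ?_, ?_⟩
    · rw [HarmonicParam.vacuum_mu]
      ext i
      · rw [hμ1 i, hs]; push_cast; ring
      · rw [hμ2 i, hs]; push_cast; ring
    · rw [HarmonicParam.vacuum_mu']
      ext i
      · rw [hμ' i, hp, hq, hn]; push_cast; ring
      · exact (Fin.cast hs i).elim0

end WorkedLines

end HodgeCM.Literature.Ichino2022
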